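import Summits.BirchSwinnertonDyer.BirchSwinnertonDyer.Theorems.ConjSpanGenAllLevelsDecomposition
import Literature.NumberTheory.Automorphic.CongruenceSubgroupPropertySL2AwayHolds
import HarnessLib

/-!
# `Δ_t(N)`-homomorphisms killing the unipotents are diamond characters — E-es-34 PROVED from Vaserstein's
# theorem over `ℤ[1/t]` (tree), with NO finite-image hypothesis and NO Ihara lemma

Summit `BirchSwinnertonDyer`, route `ManinLocalTwoThree` (cell bsd-f2-manin), deciding crux C2 `ManinOddAtFour`
(stmt-BirchSwinnertonDyer-22967) and crux C3 `ManinPrimeToThreeAtNine` (stmt-BirchSwinnertonDyer-22968).  Both active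
skeleton lines (`kato_shift_two`, `kato_shift_three`, lead p1) carry a GENERATION stub
(`stub_multiShiftClass_generation` = E-es-22, `stub_shiftClass_generation` = E-es-19) which p3's files
`Theorems/ManinLocalTwoThreeGenerationOfRelativeIhara{,Two}.lean` reduce to the relative Ihara leaf
`Summit.BirchSwinnertonDyer.Rank1Residual.ManinAdditive.RelativeIharaShiftVanishingBar p t n` (typer p596841).  The
planner's Ihara-free proof plan for that leaf (bsd-f2-manin-es g11, HOME/MEMO-es.md §23, sketch
HOME/es/Sketch-es-g11.lean) ends in the «diamond bottom»: after the cusp-symbol lift and LEMMA G, the shift-invariant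
class `u` is the restriction to `ι Γ₀(L)` of a map `φ : SL₂(ℤ[1/t]) → K` which is ADDITIVE on
`Δ_t(N) = {g : c_g ∈ N·ℤ[1/t]}` (f3-mu's `ConjSpanGenAllLevels.Delta t N`, `N = L'` the `t`-free part of the level)
and KILLS the unipotents `U⁺(x) = (1 x; 0 1)` (`x ∈ ℤ[1/t]`, they fix `∞`) and `U⁻(Ny) = (1 0; Ny 1)` (they fix
`0`).  Row **E-es-34 `EsG11.DeltaHomDiamond t N`** asserts that such a `φ` is a DIAMOND CHARACTER:
`φ(g) = η(d_g mod N)` with `η` additive on the units of `ℤ/N`; the planner's intended proof was «congruence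
subgroup property of `SL₂(ℤ[1/t])` (finite image ⟹ finite-index kernel) + LEMMA D over `ℤ/M₀`».

THIS FILE PROVES E-es-34 in a STRONGER, definition-free form, directly from **Vaserstein's theorem over
`A = ℤ[1/t]`**, which the tree holds as a THEOREM (no named fact):
`Literature.NumberTheory.Automorphic.SL2Rel.Away.relG_top_span_natCast_le_relE` — `G(A, (N)) ≤ E(A, (N))` for
`t ≥ 2`, `N ≠ 0`, i.e. every `g ∈ SL₂(A)` with `c ∈ NA`, `a ≡ d ≡ 1 (mod NA)` is a word in `U⁺(A)` and `U⁻(NA)`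
(file `Literature/NumberTheory/Automorphic/CongruenceSubgroupPropertySL2AwayHolds.lean`, the Moore-free road
Vaserstein 1972 + Liehl 1981 + Bass–Milnor–Serre Thm. 3.6).  Consequently:

* `deltaHom_eq_zero_of_mem_relE` — `φ` kills `E(A, (N))` (closure induction inside `Δ_t(N)`);
* `deltaHom_eq_zero_of_mem_relG` — `φ` kills `G(A, (N)) = {c ∈ (N), a ≡ d ≡ 1 (N)}` (Vaserstein);
* `deltaHom_eq_of_sub_mem_span` — `φ(g)` depends only on `d_g mod NA` (`g' g⁻¹ ∈ G(A,(N))` when `d_g ≡ d_{g'}`);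
* `exists_diamond_of_deltaHom` — **E-es-34, def-free**: there is `η : ZMod N → K`, additive on units, with
  `φ(ι γ) = η(d_γ mod N)` for every `γ ∈ Γ₀(N)` (hence for every `γ ∈ Γ₀(L)`, `N ∣ L`:
  `exists_diamond_of_deltaHom_of_dvd`) — exactly the shape `u = diamondFun L N K η` of the sketch's E-es-35
  `ShiftInvariantIsDiamond` second disjunct, and the input of E-es-33 `HeckeDiamond` (p1's
  `heckeU_eq_smul_of_shiftInvariant`, `Theorems/ManinLocalTwoThreeShiftInvariantHeckeEigenvalue.lean`).

What is NOT needed, compared with the sketch's E-es-34: the finite-image hypothesis, the primality of `t` (only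
`t ≥ 2`), the side condition `t ∤ N`, LEMMA D over `ℤ/M₀` (E-es-32), and any passage through a finite level `M₀`.
Nothing here is specific to elliptic curves; nothing about BSD or Manin's conjecture is proved by this file — it
supplies the bottom of the Ihara-free proof of E-es-25, which bears on 22967/22968 only through the generation stubs.

References: planner memo HOME/MEMO-es.md §23 and sketch HOME/es/Sketch-es-g11.lean §3–§5 (cell bsd-f2-manin,
rows E-es-32/34/35); L. N. Vaserstein, Mat. Sb. 89 (1972) 313–322, Theorem (tree theorem, see above);
J.-P. Serre, Ann. of Math. 92 (1970) 489–527, §2.6; B. Mazur, *Modular curves and the Eisenstein ideal*, Publ. IHÉS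
47 (1977) II.16 (diamond homomorphisms — the Eisenstein obstruction this bottom isolates).
-/

set_option autoImplicit false
set_option linter.dupNamespace false

open scoped MatrixGroups

open CongruenceSubgroup Literature.NumberTheory.Automorphic
  Summit.BirchSwinnertonDyer.BirchSwinnertonDyer.Theorems.ConjSpanGenAllLevels

namespace Summit.BirchSwinnertonDyer.BirchSwinnertonDyer.Theorems.ManinLocalTwoThree

noncomputable section

/-! ### §1  The unipotents and Vaserstein's groups sit inside `Δ_t(N)` -/

section Membership

variable {t N : ℕ}

/-- f3-mu's `upperUnip` is Vaserstein's `E₁₂` (same matrix). [folklore] -/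
theorem upperUnip_eq_e12 {A : Type*} [CommRing A] (x : A) : upperUnip x = SL2Rel.e12 x := by
  ext i j; fin_cases i <;> fin_cases j <;> rfl

/-- f3-mu's `lowerUnip` is Vaserstein's `E₂₁` (same matrix). [folklore] -/
theorem lowerUnip_eq_e21 {A : Type*} [CommRing A] (y : A) : lowerUnip y = SL2Rel.e21 y := by
  ext i j; fin_cases i <;> fin_cases j <;> rfl

/-- `U⁺(x) ∈ Δ_t(N)`. [folklore] -/
theorem upperUnip_mem_Delta (x : Away t) : upperUnip x ∈ Delta t N :=
  ⟨0, by simp [upperUnip]⟩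

/-- `U⁻(N y) ∈ Δ_t(N)`. [folklore] -/
theorem lowerUnip_mul_mem_Delta (y : Away t) : lowerUnip ((N : Away t) * y) ∈ Delta t N :=
  ⟨y, by simp [lowerUnip]⟩

/-- Unfolding membership in `Δ_t(N)`: the lower-left entry lies in the ideal `(N)`. [folklore] -/
theorem mem_Delta_iff_mem_span (g : SL(2, Away t)) :
    g ∈ Delta t N ↔ g 1 0 ∈ Ideal.span {(N : Away t)} := by
  rw [Ideal.mem_span_singleton']
  constructor
  · rintro ⟨s, hs⟩
    exact ⟨s, by rw [hs, mul_comm]⟩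
  · rintro ⟨s, hs⟩
    exact ⟨s, by rw [← hs, mul_comm]⟩

/-- Vaserstein's `E(A, (N)) ≤ Δ_t(N)`. [folklore] -/
theorem relE_top_span_le_Delta :
    SL2Rel.relE (⊤ : Ideal (Away t)) (Ideal.span {(N : Away t)}) ≤ Delta t N := by
  rw [SL2Rel.relE, Subgroup.closure_le]
  rintro g (⟨x, -, rfl⟩ | ⟨y, hy, rfl⟩)
  · rw [← upperUnip_eq_e12]
    exact upperUnip_mem_Delta x
  · obtain ⟨z, rfl⟩ := Ideal.mem_span_singleton'.1 hy
    rw [← lowerUnip_eq_e21, mul_comm]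
    exact lowerUnip_mul_mem_Delta z

/-- Vaserstein's `G(A, (N)) ≤ Δ_t(N)`. [folklore] -/
theorem relG_top_span_le_Delta :
    SL2Rel.relG (⊤ : Ideal (Away t)) (Ideal.span {(N : Away t)}) ≤ Delta t N := by
  intro g hg
  exact (mem_Delta_iff_mem_span g).2 (SL2Rel.mem_relG.1 hg).2.1

/-- `ι Γ₀(N) ≤ Δ_t(N)` on elements. [folklore] -/
theorem iota_mem_Delta {γ : SL(2, ℤ)} (hγ : γ ∈ Gamma0 N) : iota t γ ∈ Delta t N :=
  gamma0Image_le_Delta ⟨γ, hγ, rfl⟩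

end Membership

/-! ### §2  A `Δ_t(N)`-additive map killing the unipotents kills `E(A,(N))`, hence `G(A,(N))` (Vaserstein) -/

section DeltaHom

variable {t N : ℕ} {K : Type*} [AddCommGroup K] (φ : SL(2, Away t) → K)
  (hadd : ∀ g ∈ Delta t N, ∀ g' ∈ Delta t N, φ (g * g') = φ g + φ g')

include hadd

/-- A `Δ`-additive map vanishes at `1`. [folklore] -/
theorem deltaHom_one : φ 1 = 0 := by
  have h := hadd 1 (Subgroup.one_mem _) 1 (Subgroup.one_mem _)
  rw [one_mul] at h
  -- `φ 1 = φ 1 + φ 1`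
  have : φ 1 + φ 1 = φ 1 + 0 := by rw [add_zero]; exact h.symm
  exact add_left_cancel this

/-- A `Δ`-additive map is odd on `Δ`: `φ(g⁻¹) = −φ(g)`. [folklore] -/
theorem deltaHom_inv {g : SL(2, Away t)} (hg : g ∈ Delta t N) : φ g⁻¹ = -φ g := by
  have h := hadd g hg g⁻¹ (Subgroup.inv_mem _ hg)
  rw [mul_inv_cancel, deltaHom_one φ hadd] at h
  exact (neg_eq_of_add_eq_zero_right h.symm).symm

variable (hU : ∀ x : Away t, φ (upperUnip x) = 0)
  (hL : ∀ y : Away t, φ (lowerUnip ((N : Away t) * y)) = 0)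

include hU hL

/-- **`φ` kills Vaserstein's elementary group `E(A, (N))`** (`A = ℤ[1/t]`): it is generated inside `Δ_t(N)` by
elements `φ` kills. [folklore] -/
theorem deltaHom_eq_zero_of_mem_relE {g : SL(2, Away t)}
    (hg : g ∈ SL2Rel.relE (⊤ : Ideal (Away t)) (Ideal.span {(N : Away t)})) : φ g = 0 := by
  rw [SL2Rel.relE] at hg
  induction hg using Subgroup.closure_induction with
  | mem x hx =>
    rcases hx with ⟨x, -, rfl⟩ | ⟨y, hy, rfl⟩
    · rw [← upperUnip_eq_e12]; exact hU x
    · obtain ⟨z, rfl⟩ := Ideal.mem_span_singleton'.1 hy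
      rw [← lowerUnip_eq_e21, mul_comm]; exact hL z
  | one => exact deltaHom_one φ hadd
  | mul x y hx hy ihx ihy =>
    have hx' : x ∈ Delta t N := relE_top_span_le_Delta (by rw [SL2Rel.relE]; exact hx)
    have hy' : y ∈ Delta t N := relE_top_span_le_Delta (by rw [SL2Rel.relE]; exact hy)
    rw [hadd x hx' y hy', ihx, ihy, add_zero]
  | inv x hx ihx =>
    have hx' : x ∈ Delta t N := relE_top_span_le_Delta (by rw [SL2Rel.relE]; exact hx)
    rw [deltaHom_inv φ hadd hx', ihx, neg_zero]

/-- **`φ` kills `G(A, (N)) = {g : c ∈ (N), a ≡ d ≡ 1 (mod N)}`** — by VASERSTEIN'S THEOREM over `ℤ[1/t]`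
(`SL2Rel.Away.relG_top_span_natCast_le_relE`, tree theorem; needs `t ≥ 2`, `N ≠ 0`). [folklore] -/
theorem deltaHom_eq_zero_of_mem_relG (ht : 2 ≤ t) (hN : N ≠ 0) {g : SL(2, Away t)}
    (hg : g ∈ SL2Rel.relG (⊤ : Ideal (Away t)) (Ideal.span {(N : Away t)})) : φ g = 0 :=
  deltaHom_eq_zero_of_mem_relE φ hadd hU hL (SL2Rel.Away.relG_top_span_natCast_le_relE t ht N hN hg)

/-- **`φ(g)` depends only on `d_g mod N`** on `Δ_t(N)`: if `d_{g'} − d_g ∈ (N)` then `φ g' = φ g`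
(`g' g⁻¹ ∈ G(A, (N))`). [folklore] -/
theorem deltaHom_eq_of_sub_mem_span (ht : 2 ≤ t) (hN : N ≠ 0) {g g' : SL(2, Away t)}
    (hg : g ∈ Delta t N) (hg' : g' ∈ Delta t N)
    (h : g' 1 1 - g 1 1 ∈ Ideal.span {(N : Away t)}) : φ g' = φ g := by
  -- work modulo `I = (N)`
  set I : Ideal (Away t) := Ideal.span {(N : Away t)} with hI
  have hc : g 1 0 ∈ I := (mem_Delta_iff_mem_span g).1 hg
  have hc' : g' 1 0 ∈ I := (mem_Delta_iff_mem_span g').1 hg'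
  have hdet : g 0 0 * g 1 1 - g 0 1 * g 1 0 = 1 := by
    have := Matrix.det_fin_two (g : Matrix (Fin 2) (Fin 2) (Away t))
    rw [g.det_coe] at this
    exact this.symm
  have hdet' : g' 0 0 * g' 1 1 - g' 0 1 * g' 1 0 = 1 := by
    have := Matrix.det_fin_two (g' : Matrix (Fin 2) (Fin 2) (Away t))
    rw [g'.det_coe] at this
    exact this.symm
  obtain ⟨i00, i01, i10, i11⟩ := SL2Rel.inv_apply_two g
  have hmem : g' * g⁻¹ ∈ SL2Rel.relG (⊤ : Ideal (Away t)) I := by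
    refine SL2Rel.mem_relG.2 ⟨Submodule.mem_top, ?_, ?_, ?_⟩
    · rw [SL2Rel.mul_apply_two, i00, i10]
      have e : g' 1 0 * g 1 1 + g' 1 1 * -g 1 0 = g 1 1 * g' 1 0 + (-g' 1 1) * g 1 0 := by ring
      rw [e]
      exact I.add_mem (I.mul_mem_left _ hc') (I.mul_mem_left _ hc)
    · rw [Ideal.top_mul, SL2Rel.mul_apply_two, i00, i10]
      -- `a' d - b' c - 1 = -(a' (d' - d)) - b' c + (a'd' - b'c' - 1) + b' c'`
      have e : g' 0 0 * g 1 1 + g' 0 1 * -g 1 0 - 1 =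
          (-(g' 0 0)) * (g' 1 1 - g 1 1) + (-(g' 0 1)) * g 1 0 + g' 0 1 * g' 1 0 +
            (g' 0 0 * g' 1 1 - g' 0 1 * g' 1 0 - 1) := by ring
      rw [e, hdet', sub_self, add_zero]
      exact I.add_mem (I.add_mem (I.mul_mem_left _ h) (I.mul_mem_left _ hc)) (I.mul_mem_left _ hc')
    · rw [Ideal.top_mul, SL2Rel.mul_apply_two, i01, i11]
      -- `-c' b + d' a - 1 = (d' - d) a + (a d - b c - 1) + b c - c' b`
      have e : g' 1 0 * -g 0 1 + g' 1 1 * g 0 0 - 1 =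
          g 0 0 * (g' 1 1 - g 1 1) + g 0 1 * g 1 0 + (-(g 0 1)) * g' 1 0 +
            (g 0 0 * g 1 1 - g 0 1 * g 1 0 - 1) := by ring
      rw [e, hdet, sub_self, add_zero]
      exact I.add_mem (I.add_mem (I.mul_mem_left _ h) (I.mul_mem_left _ hc)) (I.mul_mem_left _ hc')
  have h0 := deltaHom_eq_zero_of_mem_relG φ hadd hU hL ht hN hmem
  have h1 : φ (g' * g⁻¹ * g) = φ (g' * g⁻¹) + φ g :=
    hadd _ (Subgroup.mul_mem _ hg' (Subgroup.inv_mem _ hg)) _ hg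
  rw [inv_mul_cancel_right, h0, zero_add] at h1
  exact h1

end DeltaHom

/-! ### §3  Every unit of `ℤ/N` is a `d`-entry of `Γ₀(N)`; the diamond character `η` -/

section Diamond

variable {t N : ℕ} {K : Type*} [AddCommGroup K]

/-- Every unit `a` of `ℤ/N` (`N ≥ 1`) is `d_γ mod N` for some `γ ∈ Γ₀(N)`: Bézout `u m + v N = 1` for a lift
`m` of `a` gives `γ = (u, −v; N, m)`. [folklore] -/
theorem exists_mem_Gamma0_apply_one_one_eq [NeZero N] {a : ZMod N} (ha : IsUnit a) :
    ∃ γ : SL(2, ℤ), γ ∈ Gamma0 N ∧ (((γ 1 1 : ℤ) : ZMod N)) = a := by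
  have hcop : Nat.Coprime a.val N := by
    rw [← ZMod.isUnit_iff_coprime, ZMod.natCast_zmod_val]; exact ha
  obtain ⟨u, v, huv⟩ := Nat.isCoprime_iff_coprime.2 hcop
  refine ⟨⟨!![u, -v; (N : ℤ), (a.val : ℤ)], ?_⟩, ?_, ?_⟩
  · rw [Matrix.det_fin_two_of]; linear_combination huv
  · rw [Gamma0_mem]
    show (((N : ℤ) : ZMod N)) = 0
    simp
  · show (((a.val : ℕ) : ℤ) : ZMod N) = a
    rw [Int.cast_natCast, ZMod.natCast_zmod_val]

/-- For `γ, γ' ∈ SL₂(ℤ)` with `d_γ ≡ d_{γ'} (mod N)`, the `d`-entries of `ι γ`, `ι γ'` differ by an element of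
`(N) ⊂ ℤ[1/t]`. [folklore] -/
theorem iota_sub_mem_span_of_cast_eq [NeZero N] {γ γ' : SL(2, ℤ)}
    (h : (((γ 1 1 : ℤ) : ZMod N)) = (((γ' 1 1 : ℤ) : ZMod N))) :
    (iota t γ') 1 1 - (iota t γ) 1 1 ∈ Ideal.span {(N : Away t)} := by
  have hd : (N : ℤ) ∣ (γ' 1 1 : ℤ) - (γ 1 1 : ℤ) := by
    rw [← ZMod.intCast_zmod_eq_zero_iff_dvd, Int.cast_sub, h, sub_self]
  obtain ⟨k, hk⟩ := hd
  rw [iota_apply, iota_apply, ← Int.cast_sub, hk, Int.cast_mul, Int.cast_natCast]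
  exact Ideal.mul_mem_right _ _ (Ideal.subset_span rfl)

variable (φ : SL(2, Away t) → K)
  (hadd : ∀ g ∈ Delta t N, ∀ g' ∈ Delta t N, φ (g * g') = φ g + φ g')
  (hU : ∀ x : Away t, φ (upperUnip x) = 0)
  (hL : ∀ y : Away t, φ (lowerUnip ((N : Away t) * y)) = 0)

include hadd hU hL

/-- On `ι Γ₀(N)` the value `φ(ι γ)` depends only on `d_γ mod N`. [folklore] -/
theorem deltaHom_iota_eq_of_cast_eq (ht : 2 ≤ t) [NeZero N] {γ γ' : SL(2, ℤ)} (hγ : γ ∈ Gamma0 N)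
    (hγ' : γ' ∈ Gamma0 N) (h : (((γ 1 1 : ℤ) : ZMod N)) = (((γ' 1 1 : ℤ) : ZMod N))) :
    φ (iota t γ') = φ (iota t γ) :=
  deltaHom_eq_of_sub_mem_span φ hadd hU hL ht (NeZero.ne N) (iota_mem_Delta hγ) (iota_mem_Delta hγ')
    (iota_sub_mem_span_of_cast_eq h)

/-- **E-es-34, definition-free and stronger (no finite image, any `t ≥ 2`, any `N ≥ 1`).**  A map
`φ : SL₂(ℤ[1/t]) → K` additive on `Δ_t(N)` and killing `U⁺(ℤ[1/t])`, `U⁻(N ℤ[1/t])` is a DIAMOND CHARACTER on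
`ι Γ₀(N)`: `φ(ι γ) = η(d_γ mod N)` with `η : ℤ/N → K` additive on units.  Proof: Vaserstein over `ℤ[1/t]`
(`deltaHom_eq_of_sub_mem_span`) + every unit is a `d`-entry (`exists_mem_Gamma0_apply_one_one_eq`). [folklore] -/
theorem exists_diamond_of_deltaHom (ht : 2 ≤ t) [NeZero N] :
    ∃ η : ZMod N → K, (∀ a b : ZMod N, IsUnit a → IsUnit b → η (a * b) = η a + η b) ∧
      ∀ γ : SL(2, ℤ), γ ∈ Gamma0 N → φ (iota t γ) = η (((γ 1 1 : ℤ) : ZMod N)) := by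
  classical
  -- `η a := φ(ι γ)` for any `γ ∈ Γ₀(N)` with `d_γ ≡ a`, and `0` if there is none (`a` not a unit)
  let η : ZMod N → K := fun a =>
    if h : ∃ γ : SL(2, ℤ), γ ∈ Gamma0 N ∧ (((γ 1 1 : ℤ) : ZMod N)) = a then φ (iota t h.choose) else 0
  have hη : ∀ γ : SL(2, ℤ), γ ∈ Gamma0 N → η (((γ 1 1 : ℤ) : ZMod N)) = φ (iota t γ) := by
    intro γ hγ
    have hex : ∃ γ₀ : SL(2, ℤ), γ₀ ∈ Gamma0 N ∧ (((γ₀ 1 1 : ℤ) : ZMod N)) = (((γ 1 1 : ℤ) : ZMod N)) :=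
      ⟨γ, hγ, rfl⟩
    simp only [η, dif_pos hex]
    exact deltaHom_iota_eq_of_cast_eq φ hadd hU hL ht hγ hex.choose_spec.1 hex.choose_spec.2.symm
  refine ⟨η, fun a b ha hb => ?_, fun γ hγ => (hη γ hγ).symm⟩
  obtain ⟨γa, hγa, rfl⟩ := exists_mem_Gamma0_apply_one_one_eq ha
  obtain ⟨γb, hγb, rfl⟩ := exists_mem_Gamma0_apply_one_one_eq hb
  -- `d_{γa γb} ≡ d_{γa} d_{γb}` since `N ∣ c_{γa}`
  have hprod : (((((γa * γb : SL(2, ℤ)) 1 1 : ℤ)) : ZMod N)) =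
      (((γa 1 1 : ℤ) : ZMod N)) * (((γb 1 1 : ℤ) : ZMod N)) := by
    have hc : (((γa 1 0 : ℤ) : ZMod N)) = 0 := (Gamma0_mem).1 hγa
    rw [SL2Rel.mul_apply_two]; push_cast; rw [hc, zero_mul, zero_add]
  rw [← hprod, hη γa hγa, hη γb hγb, hη (γa * γb) (Subgroup.mul_mem _ hγa hγb), map_mul]
  exact hadd _ (iota_mem_Delta hγa) _ (iota_mem_Delta hγb)

/-- **E-es-34 at level `L`, `N ∣ L`** (the shape `u = diamondFun L N K η` of the sketch's E-es-35): on `ι Γ₀(L)` the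
map `φ` is `γ ↦ η(d_γ mod N)`. [folklore] -/
theorem exists_diamond_of_deltaHom_of_dvd (ht : 2 ≤ t) [NeZero N] {L : ℕ} (hNL : N ∣ L) :
    ∃ η : ZMod N → K, (∀ a b : ZMod N, IsUnit a → IsUnit b → η (a * b) = η a + η b) ∧
      ∀ γ : Gamma0 L, φ (iota t (γ : SL(2, ℤ))) = η ((((γ : SL(2, ℤ)) 1 1 : ℤ) : ZMod N)) := by
  obtain ⟨η, hη, h⟩ := exists_diamond_of_deltaHom φ hadd hU hL ht
  refine ⟨η, hη, fun γ => h _ ?_⟩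
  -- `Γ₀(L) ≤ Γ₀(N)` for `N ∣ L`
  have hL0 := (Gamma0_mem).1 γ.2
  rw [Gamma0_mem]
  rw [ZMod.intCast_zmod_eq_zero_iff_dvd] at hL0 ⊢
  exact dvd_trans (Int.natCast_dvd_natCast.2 hNL) hL0

end Diamond

end

end Summit.BirchSwinnertonDyer.BirchSwinnertonDyer.Theorems.ManinLocalTwoThree
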